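import Mathlib
import HarnessLib
import Summits.Ventures.LatticeQCDFlow.Exactness.NCMCGeneralSpaceReplicaTStatisticCoverage

/-!
# The calibrating quantile EXISTS: `q ↦ L_R(q)` is continuous, vanishes at `0`, tends to `1`, and takes every value in `(0, 1)`

HONEST FRAMING: exact (Metropolis-corrected) sampling algorithms for lattice gauge theory;
figures of merit are autocorrelation/cost numbers at stated couplings and volumes; no
continuum-physics claim.

Venture `LatticeQCDFlow` (cell pub-lqcd), topic `Exactness`; FANOUT row 13 (`eng-snf`, GEN-23, replica
pooling).  NEW WORK of the cell against Mathlib (`ProbabilityTheory.cdf`, `StieltjesFunction.measure_Icc`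
/ `measure_singleton`, `Monotone.continuousAt_iff_leftLim_eq_rightLim`, the intermediate value theorem)
and the cell's `NCMCGeneralSpaceReplicaTStatisticCoverage` (the law of `t(Z)` has no atoms); not a
published result; no definition is introduced; nothing is cited as a fact (Student's `t_{R−1}` NAMED
ONLY).

WHY (row 13).  `NCMCGeneralSpaceReplicaTStatisticCoverage` / `…CoverageChains` / `…Indep` show that every
replica-`t` / "independent runs" interval read with a quantile `q` has the limiting coverage
`L_R(q) = N(0,1)^{⊗R}{z | |t(z)| ≤ q}`, so the bar is calibrated iff `L_R(q) = 1 − α`.  Typed here: such a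
`q` EXISTS for every `α ∈ (0, 1)` and every `R ≥ 2` — generically, the CDF of an atomless law on `ℝ` is
continuous, so `q ↦ μ[−q, q]` is continuous, `0` at `q = 0`, `→ 1`, hence onto `(0, 1)` on `[0, ∞)`;
applied to the (atomless) law of `t(Z)`.

## Content
* `continuous_cdf_of_nullSingletonClass`, `measure_Icc_eq_ofReal_cdf_sub`, `measureReal_Icc_eq_cdf_sub`,
  `continuous_cdf_sub_cdf_neg`, `tendsto_cdf_sub_cdf_neg_atTop`,
  **`exists_measureReal_Icc_neg_eq`** — generic, for an atomless probability law on `ℝ`.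
* **`exists_replicaT_calibrating_quantile`** — `∀ α ∈ (0,1), ∃ q ≥ 0, L_R(q) = 1 − α` (as a real
  number: `(N(0,1)^{⊗R}).real {|t| ≤ q} = 1 − α`); `replicaT_coverage_zero` (`L_R(0) = 0`),
  `tendsto_replicaT_coverage_atTop` (`L_R(q) → 1`).

NOT CLAIMED: uniqueness of `q` (it would need `L_R` strictly increasing, i.e. full support of the law of
`t(Z)`); its value (the `t_{R−1}` quantile); anything numerical.
-/

namespace Summit.Ventures.LatticeQCDFlow.Exactness.GeneralNCMC

open MeasureTheory ProbabilityTheory Filter Set Function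
open scoped ENNReal NNReal Topology

/-! ## §1 Atomless laws on `ℝ`: continuous CDF, symmetric-interval mass sweeps `(0, 1)` -/

section CDF

variable (μ : Measure ℝ) [IsProbabilityMeasure μ] [NullSingletonClass μ]

/-- **The CDF of an atomless probability law on `ℝ` is continuous.** -/
theorem continuous_cdf_of_nullSingletonClass : Continuous (cdf μ) := by
  refine continuous_iff_continuousAt.2 fun x => ?_
  rw [(monotone_cdf μ).continuousAt_iff_leftLim_eq_rightLim, (cdf μ).rightLim_eq]
  have h := (cdf μ).measure_singleton x
  rw [measure_cdf, measure_singleton, eq_comm, ENNReal.ofReal_eq_zero] at h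
  exact le_antisymm ((monotone_cdf μ).leftLim_le le_rfl) (by linarith)

/-- `μ[a, b] = cdf(b) − cdf(a)` for an atomless law. -/
theorem measure_Icc_eq_ofReal_cdf_sub (a b : ℝ) :
    μ (Icc a b) = ENNReal.ofReal (cdf μ b - cdf μ a) := by
  have h := (cdf μ).measure_Icc a b
  rw [measure_cdf] at h
  rw [h, ((continuous_cdf_of_nullSingletonClass μ).continuousAt.continuousWithinAt
    (s := Iic a)).leftLim_eq]

/-- `μ.real [a, b] = cdf(b) − cdf(a)` (`a ≤ b`) for an atomless law. -/
theorem measureReal_Icc_eq_cdf_sub {a b : ℝ} (hab : a ≤ b) :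
    μ.real (Icc a b) = cdf μ b - cdf μ a := by
  rw [measureReal_def, measure_Icc_eq_ofReal_cdf_sub,
    ENNReal.toReal_ofReal (sub_nonneg.2 (monotone_cdf μ hab))]

/-- **`q ↦ μ.real [−q, q]` is continuous on `[0, ∞)`** (indeed everywhere, as the function
`q ↦ cdf(q) − cdf(−q)` with which it agrees there). -/
theorem continuous_cdf_sub_cdf_neg : Continuous fun q : ℝ => cdf μ q - cdf μ (-q) :=
  (continuous_cdf_of_nullSingletonClass μ).sub
    ((continuous_cdf_of_nullSingletonClass μ).comp continuous_neg)

omit [IsProbabilityMeasure μ] [NullSingletonClass μ] in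
/-- `cdf(q) − cdf(−q) → 1` as `q → ∞`. -/
theorem tendsto_cdf_sub_cdf_neg_atTop : Tendsto (fun q : ℝ => cdf μ q - cdf μ (-q)) atTop (𝓝 1) := by
  have h1 := tendsto_cdf_atTop μ
  have h2 : Tendsto (fun q : ℝ => cdf μ (-q)) atTop (𝓝 0) :=
    (tendsto_cdf_atBot μ).comp tendsto_neg_atTop_atBot
  simpa using h1.sub h2

/-- **For every `α ∈ (0, 1)` there is `q ≥ 0` with `μ.real [−q, q] = 1 − α`** (atomless probability law
on `ℝ`; intermediate value theorem). -/
theorem exists_measureReal_Icc_neg_eq {α : ℝ} (hα0 : 0 < α) (hα1 : α < 1) :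
    ∃ q : ℝ, 0 ≤ q ∧ μ.real (Icc (-q) q) = 1 - α := by
  -- some `Q ≥ 0` with `g Q > 1 − α`
  obtain ⟨Q, hQ⟩ := ((tendsto_cdf_sub_cdf_neg_atTop μ).eventually
    (eventually_gt_nhds (by linarith : 1 - α < 1))).and (eventually_ge_atTop 0) |>.exists
  have hIVT := intermediate_value_Icc hQ.2 (continuous_cdf_sub_cdf_neg μ).continuousOn
  have h00 : cdf μ 0 - cdf μ (-0) = 0 := by simp
  obtain ⟨q, hq, hgq⟩ := hIVT ⟨by rw [h00]; linarith, hQ.1.le⟩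
  refine ⟨q, hq.1, ?_⟩
  rw [measureReal_Icc_eq_cdf_sub μ (by linarith [hq.1] : -q ≤ q)]
  exact hgq

end CDF

/-! ## §2 The calibrating quantile of the replica `t`-interval exists -/

section Quantile

variable {ι : Type*} [Fintype ι] [Nontrivial ι]

/-- **FOR EVERY `α ∈ (0,1)` AND `R ≥ 2` THERE IS A QUANTILE `q ≥ 0` WITH `L_R(q) = 1 − α`**:
`(N(0,1)^{⊗R}).real {z | |t(z)| ≤ q} = 1 − α` — the replica-`t` / "independent runs" bar CAN be
calibrated exactly in the limit (by the `t_{R−1}` quantile, unnamed here). -/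
theorem exists_replicaT_calibrating_quantile {α : ℝ} (hα0 : 0 < α) (hα1 : α < 1) :
    ∃ q : ℝ, 0 ≤ q ∧ (Measure.pi fun _ : ι => gaussianReal 0 1).real {z : ι → ℝ |
      |(∑ r, z r) / Fintype.card ι
        / Real.sqrt ((∑ r, (z r - (∑ r', z r') / Fintype.card ι) ^ 2)
            / ((Fintype.card ι : ℝ) * (Fintype.card ι - 1)))| ≤ q} = 1 - α := by
  haveI := nullSingletonClass_map_tStat_pi_gaussianReal (ι := ι) 0 one_ne_zero
  haveI : IsProbabilityMeasure ((Measure.pi fun _ : ι => gaussianReal 0 1).map fun z : ι → ℝ =>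
      (∑ r, z r) / Fintype.card ι
        / Real.sqrt ((∑ r, (z r - (∑ r', z r') / Fintype.card ι) ^ 2)
            / ((Fintype.card ι : ℝ) * (Fintype.card ι - 1)))) :=
    Measure.isProbabilityMeasure_map measurable_tStat_pi.aemeasurable
  obtain ⟨q, hq, h⟩ := exists_measureReal_Icc_neg_eq ((Measure.pi fun _ : ι => gaussianReal 0 1).map
    fun z : ι → ℝ => (∑ r, z r) / Fintype.card ι
        / Real.sqrt ((∑ r, (z r - (∑ r', z r') / Fintype.card ι) ^ 2)
            / ((Fintype.card ι : ℝ) * (Fintype.card ι - 1)))) hα0 hα1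
  refine ⟨q, hq, ?_⟩
  have hS : {z : ι → ℝ | |(∑ r, z r) / Fintype.card ι
        / Real.sqrt ((∑ r, (z r - (∑ r', z r') / Fintype.card ι) ^ 2)
            / ((Fintype.card ι : ℝ) * (Fintype.card ι - 1)))| ≤ q}
      = (fun z : ι → ℝ => (∑ r, z r) / Fintype.card ι
        / Real.sqrt ((∑ r, (z r - (∑ r', z r') / Fintype.card ι) ^ 2)
            / ((Fintype.card ι : ℝ) * (Fintype.card ι - 1)))) ⁻¹' Icc (-q) q := by
    ext z
    simp only [Set.mem_setOf_eq, Set.mem_preimage, Set.mem_Icc, abs_le]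
  rw [measureReal_def, Measure.map_apply measurable_tStat_pi measurableSet_Icc] at h
  rw [hS, measureReal_def]
  exact h

/-- **`L_R(0) = 0`**: `N(0,1)^{⊗R}{|t| ≤ 0} = 0` (the law of `t(Z)` has no atom at `0`). -/
theorem replicaT_coverage_zero :
    (Measure.pi fun _ : ι => gaussianReal 0 1) {z : ι → ℝ |
      |(∑ r, z r) / Fintype.card ι
        / Real.sqrt ((∑ r, (z r - (∑ r', z r') / Fintype.card ι) ^ 2)
            / ((Fintype.card ι : ℝ) * (Fintype.card ι - 1)))| ≤ 0} = 0 := by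
  have hS : {z : ι → ℝ | |(∑ r, z r) / Fintype.card ι
        / Real.sqrt ((∑ r, (z r - (∑ r', z r') / Fintype.card ι) ^ 2)
            / ((Fintype.card ι : ℝ) * (Fintype.card ι - 1)))| ≤ 0}
      = {z : ι → ℝ | (∑ r, z r) / Fintype.card ι
        / Real.sqrt ((∑ r, (z r - (∑ r', z r') / Fintype.card ι) ^ 2)
            / ((Fintype.card ι : ℝ) * (Fintype.card ι - 1))) = 0} := by
    ext z
    simp only [Set.mem_setOf_eq, abs_nonpos_iff]
  rw [hS]
  exact pi_gaussianReal_measure_tStat_eq_eq_zero 0 one_ne_zero 0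

omit [Nontrivial ι] in
/-- **`L_R(q) → 1` as `q → ∞`.** -/
theorem tendsto_replicaT_coverage_atTop :
    Tendsto (fun q : ℝ => (Measure.pi fun _ : ι => gaussianReal 0 1) {z : ι → ℝ |
      |(∑ r, z r) / Fintype.card ι
        / Real.sqrt ((∑ r, (z r - (∑ r', z r') / Fintype.card ι) ^ 2)
            / ((Fintype.card ι : ℝ) * (Fintype.card ι - 1)))| ≤ q}) atTop (𝓝 1) := by
  have hmono : Monotone (fun q : ℝ => {z : ι → ℝ |
      |(∑ r, z r) / Fintype.card ι
        / Real.sqrt ((∑ r, (z r - (∑ r', z r') / Fintype.card ι) ^ 2)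
            / ((Fintype.card ι : ℝ) * (Fintype.card ι - 1)))| ≤ q}) :=
    fun a b hab z hz => le_trans hz hab
  have hU : (⋃ q : ℝ, {z : ι → ℝ |
      |(∑ r, z r) / Fintype.card ι
        / Real.sqrt ((∑ r, (z r - (∑ r', z r') / Fintype.card ι) ^ 2)
            / ((Fintype.card ι : ℝ) * (Fintype.card ι - 1)))| ≤ q}) = Set.univ := by
    ext z
    simp only [Set.mem_iUnion, Set.mem_setOf_eq, Set.mem_univ, iff_true]
    exact ⟨_, le_rfl⟩
  have h := tendsto_measure_iUnion_atTop
    (μ := Measure.pi fun _ : ι => gaussianReal 0 (1 : ℝ≥0)) hmono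
  rw [hU, measure_univ] at h
  exact h

end Quantile

end Summit.Ventures.LatticeQCDFlow.Exactness.GeneralNCMC
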